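import Summits.Parity.GeneralizedHardyLittlewood.Theses.LeeYangFibres
import Literature.NumberTheory.Sieve.LinearEquationsInPrimesOneForm
import Literature.NumberTheory.Sieve.LinearEquationsInPrimesDimOne
import HarnessLib

/-!
# `RelativeDimOne` (stmt-Parity-14113): load-bearing hypotheses I — size, box, convexity

Negative lemmas for the crux `LeeYangFibres.RelativeDimOne` (cdisprove seat, cycle 1), part 1 — the
`d = 1` generalised Hardy–Littlewood statement in von Mangoldt form with Green–Tao's Conj. 1.4 error
`|S(Ψ,K,N) − β_∞𝔖| ≤ ε (β_∞𝔖 + N)`, uniform over non-degenerate systems `Ψ` of `t ≥ 1` forms with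
`‖Ψ‖_N ≤ L` and convex `K ⊆ [-N, N]`. With `Concl ε N Ψ K` the displayed inequality, the crux is the
`Concl`-statement under six hypotheses (`crux_iff`, `Iff.rfl`). This part: §0 vocabulary (one-form
witnesses `lin a b = (n ↦ a n + b)` with the tree's closed form `OneForm.singularProduct_eq`: `𝔖(n) = 1`,
`𝔖(q n) = 0`; the bodies `{(1)}`, segments, the punctured box) and the first three deletions, each FALSE:
* A1 `‖Ψ‖_N ≤ L` deleted (`relativeDimOne_false_without_size`): `ψ = q·n`, `q` prime `> e^N`, `K = {(1)}`:
  `S = Λ(q) = log q > N` while `𝔖 = 0`;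
* A2 `K ⊆ [-N,N]` deleted (`relativeDimOne_false_without_box`): `ψ = n`, `K = [N+1, 3N+3]`: `S = 0` (the
  sum only sees the box), `β_∞𝔖 = 2N + 2`;
* A3 `Convex K` deleted (`relativeDimOne_false_without_convex`): `ψ = n`, `K = (0,N] ∖ ℤ`: `S = 0`,
  `β_∞𝔖 = N` (convexity is what ties lattice points to volume).
Part 2 (`RelativeDimOneLoadBearingTwo`): non-degeneracy, `ε > 0`, the threshold; the false
strengthenings (purely relative error, `N₀` uniform in `L`); the true slices `t = 0`, `t = 1`. [folklore]
-/

noncomputable section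

open scoped BigOperators Classical Topology
open Finset Filter MeasureTheory Set Literature.NumberTheory.Sieve
open Summit.Parity.GeneralizedHardyLittlewood.Theses.LeeYangFibres (RelativeDimOne DimOne)

namespace Summit.Parity.GeneralizedHardyLittlewood.Theorems.RelativeDimOne.Negative
/-! ## §0 Vocabulary: the conclusion of the crux, one-form witnesses -/

/-- The conclusion of the crux at the data `(ε, N, Ψ, K)`:
`|S(Ψ,K,N) − β_∞(Ψ,K)·𝔖(Ψ)| ≤ ε (β_∞ 𝔖 + N)`. -/
def Concl {t : ℕ} (ε : ℝ) (N : ℕ) (Ψ : Fin t → AffLinForm 1) (K : Set (Fin 1 → ℝ)) : Prop :=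
  |vonMangoldtSum Ψ K N - archFactor Ψ K * singularProduct Ψ| ≤
    ε * (archFactor Ψ K * singularProduct Ψ + N)

/-- The crux, verbatim, is the `Concl`-statement with all six hypotheses
(`1 ≤ t`, `0 < ε`, `N₀ ≤ N`, non-degeneracy, size `≤ L`, convexity, `K ⊆ [-N,N]`). -/
theorem crux_iff :
    RelativeDimOne ↔
      ∀ (t L : ℕ), 1 ≤ t → ∀ ε : ℝ, 0 < ε → ∃ N₀ : ℕ, ∀ N : ℕ, N₀ ≤ N →
        ∀ Ψ : Fin t → AffLinForm 1, IsNondegenerateSystem Ψ → affLinSize Ψ N ≤ L →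
          ∀ K : Set (Fin 1 → ℝ), Convex ℝ K → K ⊆ realBox 1 N → Concl ε N Ψ K :=
  Iff.rfl

/-- The one-form system `ψ(n) = a n + b`. -/
def lin (a b : ℤ) : Fin 1 → AffLinForm 1 := fun _ => ⟨fun _ => a, b⟩

/-- `ψ(n) = a n₀ + b`. -/
theorem lin_eval (a b : ℤ) (i : Fin 1) (n : Fin 1 → ℤ) : (lin a b i).eval n = a * n 0 + b := by
  simp [lin, AffLinForm.eval]

/-- `ψ(x) = a x₀ + b` on `ℝ¹`. -/
theorem lin_realEval (a b : ℤ) (i : Fin 1) (x : Fin 1 → ℝ) :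
    (lin a b i).realEval x = (a : ℝ) * x 0 + b := by
  simp [lin, AffLinForm.realEval]

/-- `ψ(n) = a n + b` with `a ≠ 0` is a non-degenerate system (one form: the pairwise clause is empty). -/
theorem isNondegenerateSystem_lin {a : ℤ} (ha : a ≠ 0) (b : ℤ) : IsNondegenerateSystem (lin a b) := by
  refine ⟨fun i h => ha ?_, fun i j hij => absurd (Subsingleton.elim i j) hij⟩
  have := congr_fun h 0
  simpa [lin] using this

/-- `‖a n + b‖_N = |a| + |b/N|`. -/
theorem affLinSize_lin (a b : ℤ) (N : ℝ) : affLinSize (lin a b) N = |(a : ℝ)| + |(b : ℝ) / N| := by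
  simp [affLinSize, lin]

/-- `𝔖(a n + b) = 𝟙[gcd(a,b) = 1]·|a|/φ(|a|)` (tree: `OneForm.singularProduct_eq`). -/
theorem singularProduct_lin {a : ℤ} (ha : a ≠ 0) (b : ℤ) :
    singularProduct (lin a b) =
      if Int.gcd a b = 1 then ((a.natAbs : ℕ) : ℝ) / Nat.totient a.natAbs else 0 :=
  OneForm.singularProduct_eq (lin a b) (by simpa [lin] using ha)

/-- `𝔖(n) = 1`. -/
theorem singularProduct_id : singularProduct (lin 1 0) = 1 := by
  rw [singularProduct_lin one_ne_zero]
  simp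

/-- `𝔖(q n) = 0` for `q ≥ 2` (local obstruction at every prime factor of `q`). -/
theorem singularProduct_scaled {q : ℕ} (hq : 2 ≤ q) : singularProduct (lin q 0) = 0 := by
  rw [singularProduct_lin (by exact_mod_cast (show q ≠ 0 by omega))]
  have : Int.gcd (q : ℤ) 0 ≠ 1 := by
    rw [Int.gcd_zero_right, Int.natAbs_natCast]
    omega
  rw [if_neg this]

/-- The singleton body `{(1)} ⊆ ℝ¹`. -/
def pt : Set (Fin 1 → ℝ) := {fun _ => (1 : ℝ)}

/-- A singleton is convex. -/
theorem convex_pt : Convex ℝ pt := convex_singleton _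

/-- `{(1)} ⊆ [-N, N]` for `N ≥ 1`. -/
theorem pt_subset_realBox {N : ℕ} (hN : 1 ≤ N) : pt ⊆ realBox 1 N := by
  intro x hx
  rw [pt, Set.mem_singleton_iff] at hx
  subst hx
  have hN' : (1 : ℝ) ≤ N := by exact_mod_cast hN
  simp only [realBox, Set.mem_Icc]
  refine ⟨fun _ => ?_, fun _ => ?_⟩ <;> simp <;> linarith

/-- The lattice points of the box with real point in `pt` are exactly `{(1)}` (for `N ≥ 1`). -/
theorem filter_pt {N : ℕ} (hN : 1 ≤ N) :
    (latticeBox 1 N).filter (fun n => realPoint n ∈ pt) = {fun _ => (1 : ℤ)} := by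
  ext n
  simp only [Finset.mem_filter, Finset.mem_singleton, pt, Set.mem_singleton_iff, latticeBox,
    Fintype.mem_piFinset, Finset.mem_Icc]
  constructor
  · rintro ⟨-, h⟩
    funext i
    have hi := congr_fun h i
    simp only [realPoint] at hi
    exact_mod_cast hi
  · rintro rfl
    refine ⟨fun i => ?_, ?_⟩
    · show -(N : ℤ) ≤ 1 ∧ (1 : ℤ) ≤ N
      omega
    · funext i
      simp [realPoint]

/-- `S(q·n, {(1)}, N) = Λ(q)` for `N ≥ 1`. -/
theorem vonMangoldtSum_scaled_pt (q : ℕ) {N : ℕ} (hN : 1 ≤ N) :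
    vonMangoldtSum (lin q 0) pt N = ArithmeticFunction.vonMangoldt q := by
  unfold vonMangoldtSum
  rw [filter_pt hN, Finset.sum_singleton]
  simp [lin_eval, intVonMangoldt]

/-- At the data `(q·n, {(1)})` with `q` prime and `log q > N ≥ 1` the conclusion fails at `ε = 1`:
`S = log q`, main term `β_∞ · 0 = 0`. -/
theorem not_concl_scaled_pt {q N : ℕ} (hq : q.Prime) (hN : 1 ≤ N) (hlog : (N : ℝ) < Real.log q) :
    ¬ Concl 1 N (lin q 0) pt := by
  unfold Concl
  rw [vonMangoldtSum_scaled_pt q hN, singularProduct_scaled hq.two_le,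
    ArithmeticFunction.vonMangoldt_apply_prime hq]
  simp only [mul_zero, sub_zero, zero_add, one_mul, not_le]
  exact lt_of_lt_of_le hlog (le_abs_self _)

/-- A prime `q` with `log q > N`. -/
theorem exists_prime_log_gt (N : ℕ) : ∃ q : ℕ, q.Prime ∧ (N : ℝ) < Real.log q := by
  obtain ⟨q, hq, hqp⟩ := Nat.exists_infinite_primes (⌈Real.exp N⌉₊ + 1)
  refine ⟨q, hqp, ?_⟩
  have h1 : Real.exp N < q := by
    have := Nat.le_ceil (Real.exp N)
    have h2 : ((⌈Real.exp N⌉₊ + 1 : ℕ) : ℝ) ≤ q := by exact_mod_cast hq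
    push_cast at h2
    linarith
  calc (N : ℝ) = Real.log (Real.exp N) := (Real.log_exp _).symm
    _ < Real.log q := Real.log_lt_log (Real.exp_pos _) h1

/-! ## §A Load-bearing hypotheses: the crux with one hypothesis deleted is FALSE -/

/-! ### A1. The size bound `‖Ψ‖_N ≤ L` -/

/-- The crux with the size hypothesis `affLinSize Ψ N ≤ L` (and the then idle parameter `L`) deleted. -/
def RelativeDimOneWithoutSize : Prop :=
  ∀ t : ℕ, 1 ≤ t → ∀ ε : ℝ, 0 < ε → ∃ N₀ : ℕ, ∀ N : ℕ, N₀ ≤ N →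
    ∀ Ψ : Fin t → AffLinForm 1, IsNondegenerateSystem Ψ →
      ∀ K : Set (Fin 1 → ℝ), Convex ℝ K → K ⊆ realBox 1 N → Concl ε N Ψ K

/-- Sanity: the variant is the crux minus a hypothesis (it implies the crux). -/
theorem relativeDimOneWithoutSize_imp : RelativeDimOneWithoutSize → RelativeDimOne := by
  intro h t L ht ε hε
  obtain ⟨N₀, hN₀⟩ := h t ht ε hε
  exact ⟨N₀, fun N hN Ψ hΨ _ K hK hKN => hN₀ N hN Ψ hΨ K hK hKN⟩

/-- **The size bound is load-bearing.** Witness: `t = 1`, `ψ(n) = q n` with `q` a prime `> e^N`,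
`K = {(1)}`: `S = Λ(q) = log q > N` while `𝔖 = 0` (`β_q = 0`), so `|S − 0| ≤ 1·(0 + N)` fails.
(Any proof must use `‖Ψ‖_N ≤ L`: it is what bounds the values, hence each `Λ`, by `log((L+1)N)`.) -/
theorem relativeDimOne_false_without_size : ¬ RelativeDimOneWithoutSize := by
  intro h
  obtain ⟨N₀, hN₀⟩ := h 1 le_rfl 1 one_pos
  obtain ⟨q, hq, hlog⟩ := exists_prime_log_gt (max N₀ 1)
  have hq0 : (q : ℤ) ≠ 0 := by exact_mod_cast hq.ne_zero
  exact not_concl_scaled_pt hq (le_max_right _ _) hlog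
    (hN₀ (max N₀ 1) (le_max_left _ _) (lin q 0) (isNondegenerateSystem_lin hq0 0) pt convex_pt
      (pt_subset_realBox (le_max_right _ _)))

/-! ### A2. The body constraint `K ⊆ [-N, N]` -/

/-- The crux with the hypothesis `K ⊆ realBox 1 N` deleted. -/
def RelativeDimOneWithoutBox : Prop :=
  ∀ (t L : ℕ), 1 ≤ t → ∀ ε : ℝ, 0 < ε → ∃ N₀ : ℕ, ∀ N : ℕ, N₀ ≤ N →
    ∀ Ψ : Fin t → AffLinForm 1, IsNondegenerateSystem Ψ → affLinSize Ψ N ≤ L →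
      ∀ K : Set (Fin 1 → ℝ), Convex ℝ K → Concl ε N Ψ K

/-- Sanity: the variant is the crux minus a hypothesis (it implies the crux). -/
theorem relativeDimOneWithoutBox_imp : RelativeDimOneWithoutBox → RelativeDimOne := by
  intro h t L ht ε hε
  obtain ⟨N₀, hN₀⟩ := h t L ht ε hε
  exact ⟨N₀, fun N hN Ψ hΨ hL K hK _ => hN₀ N hN Ψ hΨ hL K hK⟩

/-- The interval body `[a, b] ⊆ ℝ¹`. -/
def seg (a b : ℝ) : Set (Fin 1 → ℝ) := Set.Icc (fun _ => a) (fun _ => b)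

/-- Segments are convex. -/
theorem convex_seg (a b : ℝ) : Convex ℝ (seg a b) := convex_Icc _ _

/-- Membership in a segment of `ℝ¹`. -/
theorem mem_seg {a b : ℝ} {x : Fin 1 → ℝ} : x ∈ seg a b ↔ a ≤ x 0 ∧ x 0 ≤ b := by
  simp only [seg, Set.mem_Icc, Pi.le_def, Fin.forall_fin_one]

/-- A segment inside `[-N, N]`. -/
theorem seg_subset_realBox {a b : ℝ} {N : ℕ} (ha : -(N : ℝ) ≤ a) (hb : b ≤ N) :
    seg a b ⊆ realBox 1 N := by
  intro x hx
  rw [mem_seg] at hx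
  simp only [realBox, Set.mem_Icc, Pi.le_def, Fin.forall_fin_one]
  exact ⟨by linarith [hx.1], by linarith [hx.2]⟩

/-- `β_∞(n; [a,b]) = b − a` for `0 < a ≤ b` (the whole segment lies in `{x > 0}`). -/
theorem archFactor_id_seg {a b : ℝ} (ha : 0 < a) (hab : a ≤ b) :
    archFactor (lin 1 0) (seg a b) = b - a := by
  unfold archFactor
  have hset : seg a b ∩ {x | ∀ i, 0 < (lin 1 0 i).realEval x} = seg a b := by
    refine Set.inter_eq_left.mpr fun x hx i => ?_
    rw [mem_seg] at hx
    rw [lin_realEval]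
    push_cast
    linarith [hx.1]
  rw [hset, seg, Real.volume_Icc_pi_toReal (fun _ => hab)]
  simp

/-- If no lattice point of the box has its real point in `K`, the sum `S` vanishes. -/
theorem vonMangoldtSum_eq_zero_of_forall {t : ℕ} (Ψ : Fin t → AffLinForm 1) {K : Set (Fin 1 → ℝ)}
    {N : ℕ} (h : ∀ n ∈ latticeBox 1 N, realPoint n ∈ K → ∏ i, intVonMangoldt ((Ψ i).eval n) = 0) :
    vonMangoldtSum Ψ K N = 0 := by
  unfold vonMangoldtSum
  refine Finset.sum_eq_zero fun n hn => ?_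
  rw [Finset.mem_filter] at hn
  exact h n hn.1 hn.2

/-- Lattice points of the box `[-N, N]¹`. -/
theorem mem_latticeBox_one {N : ℕ} {n : Fin 1 → ℤ} (hn : n ∈ latticeBox 1 N) :
    -(N : ℤ) ≤ n 0 ∧ n 0 ≤ N := by
  simpa [latticeBox, Fintype.mem_piFinset] using hn

/-- **`K ⊆ [-N, N]` is load-bearing.** Witness: `t = 1`, `ψ(n) = n`, `K = [N+1, 3N+3]` (convex,
outside the box): `S = 0` (no lattice point of `[-N,N]` lies in `K`) while `β_∞ 𝔖 = 2N + 2`, so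
`|0 − (2N+2)| ≤ ½ (2N + 2 + N)` fails. (The sum only sees the box; the main term sees all of `K`.) -/
theorem relativeDimOne_false_without_box : ¬ RelativeDimOneWithoutBox := by
  intro h
  obtain ⟨N₀, hN₀⟩ := h 1 1 le_rfl (1 / 2) (by norm_num)
  set N := max N₀ 1 with hNdef
  have hN1 : 1 ≤ N := le_max_right _ _
  have hNr : (1 : ℝ) ≤ N := by exact_mod_cast hN1
  have key := hN₀ N (le_max_left _ _) (lin 1 0) (isNondegenerateSystem_lin one_ne_zero 0)
    (by rw [affLinSize_lin]; simp) (seg ((N : ℝ) + 1) (3 * N + 3)) (convex_seg _ _)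
  unfold Concl at key
  rw [archFactor_id_seg (by linarith) (by linarith), singularProduct_id,
    vonMangoldtSum_eq_zero_of_forall] at key
  · rw [mul_one, zero_sub, abs_neg, abs_of_nonneg (by linarith)] at key
    linarith
  · intro n hn hK
    exfalso
    have h1 := (mem_latticeBox_one hn).2
    have h2 := (mem_seg.mp hK).1
    simp only [realPoint] at h2
    have h3 : ((n 0 : ℤ) : ℝ) ≤ N := by exact_mod_cast h1
    linarith

/-! ### A3. Convexity of `K` -/

/-- The crux with the hypothesis `Convex ℝ K` deleted. -/
def RelativeDimOneWithoutConvex : Prop :=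
  ∀ (t L : ℕ), 1 ≤ t → ∀ ε : ℝ, 0 < ε → ∃ N₀ : ℕ, ∀ N : ℕ, N₀ ≤ N →
    ∀ Ψ : Fin t → AffLinForm 1, IsNondegenerateSystem Ψ → affLinSize Ψ N ≤ L →
      ∀ K : Set (Fin 1 → ℝ), K ⊆ realBox 1 N → Concl ε N Ψ K

/-- Sanity: the variant is the crux minus a hypothesis (it implies the crux). -/
theorem relativeDimOneWithoutConvex_imp : RelativeDimOneWithoutConvex → RelativeDimOne := by
  intro h t L ht ε hε
  obtain ⟨N₀, hN₀⟩ := h t L ht ε hε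
  exact ⟨N₀, fun N hN Ψ hΨ hL K _ hKN => hN₀ N hN Ψ hΨ hL K hKN⟩

/-- The punctured body `(0, N] ∖ ℤ ⊆ ℝ¹`: full measure `N`, no lattice point. -/
def punctured (N : ℕ) : Set (Fin 1 → ℝ) :=
  Set.pi Set.univ (fun _ : Fin 1 => Set.Ioc (0 : ℝ) N) \ ⋃ z : ℤ, {x | x 0 = (z : ℝ)}

/-- `(0, N] ∖ ℤ ⊆ [-N, N]`. -/
theorem punctured_subset_realBox (N : ℕ) : punctured N ⊆ realBox 1 N := by
  intro x hx
  have hx1 := hx.1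
  simp only [Set.mem_pi, Set.mem_univ, true_implies, Set.mem_Ioc] at hx1
  simp only [realBox, Set.mem_Icc, Pi.le_def]
  have hN : (0 : ℝ) ≤ N := Nat.cast_nonneg N
  exact ⟨fun i => by linarith [(hx1 i).1], fun i => (hx1 i).2⟩

/-- The hyperplanes `{x₀ = z}`, `z ∈ ℤ`, of `ℝ¹` form a null set. -/
theorem volume_iUnion_intSlices : volume (⋃ z : ℤ, {x : Fin 1 → ℝ | x 0 = (z : ℝ)}) = 0 := by
  refine measure_iUnion_null_iff.mpr fun z => ?_
  refine measure_mono_null (t := Set.Icc (fun _ => (z : ℝ)) (fun _ => (z : ℝ))) ?_ ?_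
  · intro x hx
    simp only [Set.mem_setOf_eq] at hx
    simp only [Set.mem_Icc, Pi.le_def, Fin.forall_fin_one, hx, le_refl, and_self]
  · rw [Real.volume_Icc_pi]
    simp

/-- `β_∞(n; (0,N] ∖ ℤ) = N`. -/
theorem archFactor_id_punctured (N : ℕ) : archFactor (lin 1 0) (punctured N) = N := by
  unfold archFactor
  have hset : punctured N ∩ {x | ∀ i, 0 < (lin 1 0 i).realEval x} = punctured N := by
    refine Set.inter_eq_left.mpr fun x hx i => ?_
    have hx1 := hx.1
    simp only [Set.mem_pi, Set.mem_univ, true_implies, Set.mem_Ioc] at hx1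
    rw [lin_realEval]
    push_cast
    linarith [(hx1 0).1]
  rw [hset, punctured, measure_sdiff_null volume_iUnion_intSlices,
    Real.volume_pi_Ioc_toReal (fun _ => Nat.cast_nonneg N)]
  simp

/-- **Convexity is load-bearing.** Witness: `t = 1`, `ψ(n) = n`, `K = (0, N] ∖ ℤ` (in the box, not
convex): `S = 0` (no lattice point) while `β_∞ 𝔖 = N·1`, so `|0 − N| ≤ ¼ (N + N)` fails for `N ≥ 1`.
(Convexity is what ties the lattice-point count of `K` to its volume.) -/
theorem relativeDimOne_false_without_convex : ¬ RelativeDimOneWithoutConvex := by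
  intro h
  obtain ⟨N₀, hN₀⟩ := h 1 1 le_rfl (1 / 4) (by norm_num)
  set N := max N₀ 1 with hNdef
  have hN1 : 1 ≤ N := le_max_right _ _
  have hNr : (1 : ℝ) ≤ N := by exact_mod_cast hN1
  have key := hN₀ N (le_max_left _ _) (lin 1 0) (isNondegenerateSystem_lin one_ne_zero 0)
    (by rw [affLinSize_lin]; simp) (punctured N) (punctured_subset_realBox N)
  unfold Concl at key
  rw [archFactor_id_punctured, singularProduct_id, vonMangoldtSum_eq_zero_of_forall] at key
  · rw [mul_one, zero_sub, abs_neg, abs_of_nonneg (by linarith)] at key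
    linarith
  · intro n _ hK
    exfalso
    have h2 := hK.2
    apply h2
    simp only [Set.mem_iUnion, Set.mem_setOf_eq, realPoint]
    exact ⟨n 0, rfl⟩

end Summit.Parity.GeneralizedHardyLittlewood.Theorems.RelativeDimOne.Negative
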